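import Summits.Ventures.HodgeRepro2.T5CyclotomicFourSplitPrime
import Summits.Ventures.HodgeRepro2.T5CyclotomicSevenHeckeCommutative

/-!
# THE CENSUS OF THE PLACES OF THE TOY FIELD `ℚ(i)` OVER `ℚ(i)⁺ = ℚ`: `v` stays prime iff `p ≡ 3 (mod 4)` iff `−1` is a
# non-square modulo `p`; the record's Hecke algebra is commutative at every odd place

Tier-5 support N3 / §G-N4.2 (seat p3, gen 79). Files 259–263 treat the inert (`p ≡ 3 mod 4`) and split (`p ≡ 1 mod 4`)
families of the toy field one at a time. This file is the census of file 266 for `ℚ(i)`: for every odd prime `p`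
and EVERY place `v` of `ℚ(i)⁺` above `p`, `N(v) = p` (the norm divides `N((p)) = p^{[ℚ(i)⁺ : ℚ]} = p`), `f(v/p) = 1`,
`e = 1`, `f(w/v) = orderOf (p mod 4) ∈ {1, 2}`, and `v` stays prime in `ℚ(i)` iff `p ≡ 3 (mod 4)` iff `−1` is NOT a
square modulo `p` (Mathlib's `ZMod.exists_sq_eq_neg_one_iff`) — the classical criterion for `ℚ(i) = ℚ(√−1)`; the
dyadic place is RAMIFIED (`e(w/v) = 2`, Mathlib's `ramificationIdx_eq_of_prime_pow` at `2²`); and, as in file 268,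
`H(U(1 ⊗ H₀), K_v)` is commutative at every odd place:

* `absNorm_eq`, `inertiaDeg_eq_one`, `ramificationIdx_eq_one`, `ramificationIdx_over_eq_one`,
  **`inertiaDeg_over_eq_orderOf`** — the local data at `v ∣ p`, `p` odd;
* `natCast_zmod_four_eq_one_or_three`, `orderOf_eq_two_iff_mod_four`, `orderOf_eq_one_iff_mod_four` — the order
  of an odd `p` modulo `4`;
* **`ncard_primesOver_eq_one_iff`**, **`exists_map_eq_iff_mod_four`**, **`exists_map_eq_iff_not_isSquare_neg_one`** —
  the census; **`heckeAlgebra_mul_comm_record_four`**, `heckeAlgebra_mul_comm_record_four_of_notMem` — commutativity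
  at every place `v` with `2 ∉ v`;
* the dyadic place: `ramificationIdx_of_liesOver_two` (`e(P/2) = 2`), `inertiaDeg_of_liesOver_two`,
  **`ramificationIdx_over_eq_two_of_liesOver_two`** (`e(w/v) = 2`), `absNorm_eq_two`.

§8(d): uses an L-value-free non-vanishing device: NO.
-/

open Matrix NumberField NumberField.IsCMField IsDedekindDomain IsDedekindDomain.HeightOneSpectrum Module Polynomial
  MulAction
open scoped TensorProduct Pointwise
open Summit.Ventures.HodgeRepro2.T5UnitaryGroupForm Summit.Ventures.HodgeRepro2.T5UnitaryHeckeAdjoint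
  Summit.Ventures.HodgeRepro2.T5HeckePermutationModule Summit.Ventures.HodgeRepro2.T5HeckeDoubleCoset
  Summit.Ventures.HodgeRepro2.T5RecordHyperspecial Summit.Ventures.HodgeRepro2.T5GlobalLatticeAlmostAll
  Summit.Ventures.HodgeRepro2.T5FinitePlaceSplitClassification Summit.Ventures.HodgeRepro2.T5RecordSatakeIntrinsic
  Summit.Ventures.HodgeRepro2.T5CMFieldSquareDatum Summit.Ventures.HodgeRepro2.T5RecordSatakeToy
  Summit.Ventures.HodgeRepro2.T5RecordSatakeSplitToy Summit.Ventures.HodgeRepro2.T5SplitPlaceUnitaryGroup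
  Summit.Ventures.HodgeRepro2.T5NonSplitPlaceUnitaryGroup Summit.Ventures.HodgeRepro2.T5FinitePlaceCM
  Summit.Ventures.HodgeRepro2.T5StarOfInvolution Summit.Ventures.HodgeRepro2.T5RecordSatake
  Summit.Ventures.HodgeRepro2.T5RecordSatakeInert Summit.Ventures.HodgeRepro2.T5FinitePlaceSplitIff
  Summit.Ventures.HodgeRepro2.T5FinitePlaceLocalDegree Summit.Ventures.HodgeRepro2.T5RecordSatakeInertToy
  Summit.Ventures.HodgeRepro2.T5CMCensusToy Summit.Ventures.HodgeRepro2.T5RecordSatakeInertToyDegree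
  Summit.Ventures.HodgeRepro2.T5CyclotomicFourInertPrime Summit.Ventures.HodgeRepro2.T5CyclotomicFourSplitPrime
  Summit.Ventures.HodgeRepro2.T5CyclotomicSevenHeckeCommutative

namespace Summit.Ventures.HodgeRepro2.T5CyclotomicFourPlaceCensus

section Arithmetic

variable (p : ℕ) [hp : Fact p.Prime]

/-- A prime not dividing `4` is odd. -/
theorem mod_two_eq_one (h2 : ¬ p ∣ 2 ^ 2) : p % 2 = 1 := by
  rcases Nat.Prime.eq_two_or_odd hp.out with h | h
  · exfalso
    apply h2
    rw [h]
    exact dvd_pow_self 2 (by norm_num)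
  · exact h

/-- An odd prime is `1` or `3` modulo `4`. -/
theorem mod_four_eq_one_or_three (h2 : ¬ p ∣ 2 ^ 2) : p % 4 = 1 ∨ p % 4 = 3 := by
  have hne := mod_two_eq_one p h2
  omega

/-- An odd prime is `1` or `3` modulo `4`, in `ZMod 4`. -/
theorem natCast_zmod_four_eq_one_or_three (h2 : ¬ p ∣ 2 ^ 2) :
    (p : ZMod (2 ^ 2)) = 1 ∨ (p : ZMod (2 ^ 2)) = 3 := by
  rw [← ZMod.natCast_mod p (2 ^ 2)]
  rcases mod_four_eq_one_or_three p h2 with h | h <;> rw [show (2 : ℕ) ^ 2 = 4 from rfl, h] <;> simp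

/-- `orderOf (p mod 4) = 2 ↔ p ≡ 3 (mod 4)` for an odd prime `p`. -/
theorem orderOf_eq_two_iff_mod_four (h2 : ¬ p ∣ 2 ^ 2) : orderOf (p : ZMod (2 ^ 2)) = 2 ↔ p % 4 = 3 := by
  have hmod : ((p % 4 : ℕ) : ZMod (2 ^ 2)) = (p : ZMod (2 ^ 2)) := ZMod.natCast_mod p (2 ^ 2)
  rcases natCast_zmod_four_eq_one_or_three p h2 with h | h
  · rw [h, orderOf_one]
    constructor
    · intro h1
      exact absurd h1 (by norm_num)
    · intro h3
      rw [← hmod, h3] at h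
      exact absurd h (by decide)
  · rw [h]
    constructor
    · intro _
      by_contra h3
      have h1 : p % 4 = 1 := (mod_four_eq_one_or_three p h2).resolve_right h3
      rw [← hmod, h1] at h
      exact absurd h (by decide)
    · intro _
      rw [orderOf_eq_iff (by norm_num)]
      decide

/-- `orderOf (p mod 4) = 1 ↔ p ≡ 1 (mod 4)` for an odd prime `p`. -/
theorem orderOf_eq_one_iff_mod_four (h2 : ¬ p ∣ 2 ^ 2) : orderOf (p : ZMod (2 ^ 2)) = 1 ↔ p % 4 = 1 := by
  have hmod : ((p % 4 : ℕ) : ZMod (2 ^ 2)) = (p : ZMod (2 ^ 2)) := ZMod.natCast_mod p (2 ^ 2)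
  rcases natCast_zmod_four_eq_one_or_three p h2 with h | h
  · rw [h, orderOf_one]
    constructor
    · intro _
      by_contra h1
      have h3 : p % 4 = 3 := (mod_four_eq_one_or_three p h2).resolve_left h1
      rw [← hmod, h3] at h
      exact absurd h (by decide)
    · intro _
      rfl
  · rw [h, show orderOf (3 : ZMod (2 ^ 2)) = 2 by rw [orderOf_eq_iff (by norm_num)]; decide]
    constructor
    · intro h21
      exact absurd h21 (by norm_num)
    · intro h1
      rw [← hmod, h1] at h
      exact absurd h (by decide)

end Arithmetic

section Four

variable (L : Type*) [Field L] [CharZero L] [IsCyclotomicExtension {2 ^ 2} ℚ L]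
variable (p : ℕ) [hp : Fact p.Prime]
variable (v : HeightOneSpectrum (𝓞 (maximalRealSubfield L))) [hv : v.asIdeal.LiesOver (Ideal.span {(p : ℤ)})]
include hv

omit [CharZero L] [IsCyclotomicExtension {2 ^ 2} ℚ L] hp in
/-- `(p) ≤ v` in `𝓞_{ℚ(i)⁺}`. -/
theorem span_natCast_le [NumberField L] : Ideal.span {(p : 𝓞 (maximalRealSubfield L))} ≤ v.asIdeal := by
  rw [Ideal.span_le, Set.singleton_subset_iff, SetLike.mem_coe]
  have hmem : (p : ℤ) ∈ Ideal.span {(p : ℤ)} := Ideal.mem_span_singleton_self (p : ℤ)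
  rw [Ideal.mem_of_liesOver v.asIdeal (Ideal.span {(p : ℤ)}) p, map_natCast] at hmem
  exact hmem

/-- **`N(v) = p`** for every place `v` of `ℚ(i)⁺` above `p`: `N(v)` divides `N((p)) = p^{[ℚ(i)⁺ : ℚ]} = p` and is
not `1`. -/
theorem absNorm_eq :
    haveI := numberField L; haveI := isCMField_four L
    Ideal.absNorm v.asIdeal = p := by
  haveI := numberField L
  haveI := isCMField_four L
  have hspan : Ideal.absNorm (Ideal.span {(p : 𝓞 (maximalRealSubfield L))}) = p := by
    rw [Ideal.absNorm_span_natCast, RingOfIntegers.rank, finrank_rat_maximalRealSubfield L, pow_one]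
  have hdvd : Ideal.absNorm v.asIdeal ∣ p := by
    rw [← hspan]
    exact Ideal.absNorm_dvd_absNorm_of_le (span_natCast_le L p v)
  rcases (Nat.dvd_prime hp.out).mp hdvd with h | h
  · exact absurd (Ideal.absNorm_eq_one_iff.mp h) v.isPrime.ne_top
  · exact h

/-- **`f(v/p) = 1`**: `p^{f(v/p)} = N(v) = p`. -/
theorem inertiaDeg_eq_one :
    haveI := numberField L; haveI := isCMField_four L
    v.asIdeal.inertiaDeg ℤ = 1 := by
  haveI := numberField L
  haveI := isCMField_four L
  have h := Ideal.absNorm_pow_inertiaDeg (Ideal.span {(p : ℤ)}) v.asIdeal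
  rw [T5CyclotomicFourInertPrime.absNorm_span_natCast_int, absNorm_eq L p v] at h
  exact Nat.pow_right_injective hp.out.two_le (h.trans (pow_one p).symm)

variable (w : HeightOneSpectrum (𝓞 L)) [hw : w.asIdeal.LiesOver v.asIdeal]
include hw

/-- **`f(w/v) = orderOf (p mod 4)`** for an odd prime `p` (the tower law with `f(v/p) = 1`). -/
theorem inertiaDeg_over_eq_orderOf (h2 : ¬ p ∣ 2 ^ 2) :
    haveI := numberField L; haveI := isCMField_four L
    w.asIdeal.inertiaDeg (𝓞 (maximalRealSubfield L)) = orderOf (p : ZMod (2 ^ 2)) := by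
  haveI := numberField L
  haveI := isCMField_four L
  haveI : w.asIdeal.LiesOver (Ideal.span {(p : ℤ)}) := Ideal.LiesOver.trans w.asIdeal v.asIdeal _
  have htower := Ideal.inertiaDeg_tower (R := ℤ) v.asIdeal w.asIdeal
  rw [IsCyclotomicExtension.Rat.inertiaDeg_eq_of_not_dvd (m := 2 ^ 2) p L w.asIdeal h2, inertiaDeg_eq_one L p v,
    one_mul] at htower
  exact htower.symm

/-- **`e(w/v) = 1`** for an odd prime `p`. -/
theorem ramificationIdx_over_eq_one (h2 : ¬ p ∣ 2 ^ 2) :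
    haveI := numberField L; haveI := isCMField_four L
    w.asIdeal.ramificationIdx (𝓞 (maximalRealSubfield L)) = 1 := by
  haveI := numberField L
  haveI := isCMField_four L
  haveI : w.asIdeal.LiesOver (Ideal.span {(p : ℤ)}) := Ideal.LiesOver.trans w.asIdeal v.asIdeal _
  have htower := Ideal.ramificationIdx_tower (R := ℤ) v.asIdeal w.asIdeal
  rw [IsCyclotomicExtension.Rat.ramificationIdx_eq_of_not_dvd (m := 2 ^ 2) p L w.asIdeal h2] at htower
  exact Nat.eq_one_of_mul_eq_one_left htower.symm

/-- **`e(v/p) = 1`** for an odd prime `p`. -/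
theorem ramificationIdx_eq_one (h2 : ¬ p ∣ 2 ^ 2) :
    haveI := numberField L; haveI := isCMField_four L
    v.asIdeal.ramificationIdx ℤ = 1 := by
  haveI := numberField L
  haveI := isCMField_four L
  haveI : w.asIdeal.LiesOver (Ideal.span {(p : ℤ)}) := Ideal.LiesOver.trans w.asIdeal v.asIdeal _
  have htower := Ideal.ramificationIdx_tower (R := ℤ) v.asIdeal w.asIdeal
  rw [IsCyclotomicExtension.Rat.ramificationIdx_eq_of_not_dvd (m := 2 ^ 2) p L w.asIdeal h2] at htower
  exact Nat.eq_one_of_mul_eq_one_right htower.symm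

omit w hw in
/-- **`#{w ∣ v} · orderOf (p mod 4) = 2`** for an odd prime `p`. -/
theorem ncard_primesOver_mul_orderOf (h2 : ¬ p ∣ 2 ^ 2) :
    haveI := numberField L; haveI := isCMField_four L
    (v.asIdeal.primesOver (𝓞 L)).ncard * orderOf (p : ZMod (2 ^ 2)) = 2 := by
  haveI := numberField L
  haveI := isCMField_four L
  obtain ⟨⟨P, hP, hPo⟩⟩ := Ideal.nonempty_primesOver (S := 𝓞 L) v.asIdeal
  haveI := hP
  haveI := hPo
  have h := ncard_primesOver_mul_eq_two L v
  rw [Ideal.ramificationIdxIn_eq_ramificationIdx v.asIdeal P (L ≃ₐ[maximalRealSubfield L] L),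
    Ideal.inertiaDegIn_eq_inertiaDeg v.asIdeal P (L ≃ₐ[maximalRealSubfield L] L),
    ramificationIdx_over_eq_one L p v ⟨P, hP, Ideal.ne_bot_of_liesOver_of_ne_bot v.ne_bot P⟩ (hw := hPo) h2,
    inertiaDeg_over_eq_orderOf L p v ⟨P, hP, Ideal.ne_bot_of_liesOver_of_ne_bot v.ne_bot P⟩ (hw := hPo) h2,
    one_mul] at h
  exact h

omit w hw in
/-- **ONE place of `ℚ(i)` above `v` iff `p ≡ 3 (mod 4)`.** -/
theorem ncard_primesOver_eq_one_iff (h2 : ¬ p ∣ 2 ^ 2) :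
    haveI := numberField L; haveI := isCMField_four L
    (v.asIdeal.primesOver (𝓞 L)).ncard = 1 ↔ p % 4 = 3 := by
  haveI := numberField L
  haveI := isCMField_four L
  have h := ncard_primesOver_mul_orderOf L p v h2
  rw [← orderOf_eq_two_iff_mod_four p h2]
  rcases natCast_zmod_four_eq_one_or_three p h2 with h1 | h3
  · rw [h1, orderOf_one] at h ⊢
    omega
  · rw [h3, show orderOf (3 : ZMod (2 ^ 2)) = 2 by rw [orderOf_eq_iff (by norm_num)]; decide] at h ⊢
    omega

omit w hw in
/-- **`v` STAYS PRIME in `ℚ(i)` iff `p ≡ 3 (mod 4)`.** -/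
theorem exists_map_eq_iff_mod_four (h2 : ¬ p ∣ 2 ^ 2) :
    haveI := numberField L; haveI := isCMField_four L
    (∃ w : HeightOneSpectrum (𝓞 L),
      Ideal.map (algebraMap (𝓞 (maximalRealSubfield L)) (𝓞 L)) v.asIdeal = w.asIdeal) ↔ p % 4 = 3 := by
  haveI := numberField L
  haveI := isCMField_four L
  rw [← ncard_primesOver_eq_one_iff L p v h2]
  constructor
  · rintro ⟨w, hw⟩
    haveI := liesOver_of_map_eq L v w hw
    exact ncard_primesOver_eq_one_of_staysPrime L v w hw
  · intro h1
    obtain ⟨⟨P, hP, hPo⟩⟩ := Ideal.nonempty_primesOver (S := 𝓞 L) v.asIdeal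
    haveI := hP
    haveI := hPo
    refine ⟨⟨P, hP, Ideal.ne_bot_of_liesOver_of_ne_bot v.ne_bot P⟩,
      map_eq_of_ramificationIdx'_eq_one_of_ncard_primesOver_eq_one L v
        ⟨P, hP, Ideal.ne_bot_of_liesOver_of_ne_bot v.ne_bot P⟩ ?_ h1⟩
    rw [Ideal.ramificationIdx'_eq_ramificationIdx v.asIdeal P v.ne_bot]
    exact ramificationIdx_over_eq_one L p v ⟨P, hP, Ideal.ne_bot_of_liesOver_of_ne_bot v.ne_bot P⟩ (hw := hPo) h2

omit w hw in
/-- **THE QUADRATIC-RESIDUE CRITERION FOR `ℚ(i) = ℚ(√−1)`: `v` stays prime in `ℚ(i)` iff `−1` is NOT a square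
modulo `p`** (Mathlib's `ZMod.exists_sq_eq_neg_one_iff`). -/
theorem exists_map_eq_iff_not_isSquare_neg_one (h2 : ¬ p ∣ 2 ^ 2) :
    haveI := numberField L; haveI := isCMField_four L
    (∃ w : HeightOneSpectrum (𝓞 L),
      Ideal.map (algebraMap (𝓞 (maximalRealSubfield L)) (𝓞 L)) v.asIdeal = w.asIdeal) ↔
      ¬ IsSquare (-1 : ZMod p) := by
  haveI := numberField L
  haveI := isCMField_four L
  rw [exists_map_eq_iff_mod_four L p v h2, ZMod.exists_sq_eq_neg_one_iff, not_not]

omit w hw in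
/-- **THE RECORD'S SPHERICAL HECKE ALGEBRA ON `ℚ(i)` IS COMMUTATIVE AT EVERY PLACE ABOVE AN ODD PRIME** (the two
branches: `p ≡ 3`: stays prime, file 236; `p ≡ 1`: two places, file 250). -/
theorem heckeAlgebra_mul_comm_record_four (h2 : ¬ p ∣ 2 ^ 2) (k : Type*) [Field k] {r : ℕ} (l : Fin r → 𝓞 L)
    (hl : Submodule.span (𝓞 (maximalRealSubfield L)) (Set.range l) = ⊤)
    (T S : (haveI := numberField L; haveI := isCMField_four L; letI := tensorStarRing L v;
      ↥(heckeAlgebra k (recordHyperspecial L v l (gramToy L))))) :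
    T * S = S * T :=
  haveI := numberField L
  haveI := isCMField_four L
  (ncard_primesOver_eq_one_or_two L v).elim
    (fun h1 =>
      (Ideal.nonempty_primesOver (S := 𝓞 L) v.asIdeal).elim fun P =>
        haveI := P.2.1
        haveI := P.2.2
        @T5RecordSatakeIntrinsic.heckeAlgebra_mul_comm_record_of_staysPrime L _ (numberField L) (isCMField_four L)
          v ⟨P.1, P.2.1, Ideal.ne_bot_of_liesOver_of_ne_bot v.ne_bot P.1⟩ P.2.2 _ l k _ hl
          (map_eq_of_ramificationIdx'_eq_one_of_ncard_primesOver_eq_one L v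
            ⟨P.1, P.2.1, Ideal.ne_bot_of_liesOver_of_ne_bot v.ne_bot P.1⟩
            (by
              rw [Ideal.ramificationIdx'_eq_ramificationIdx v.asIdeal P.1 v.ne_bot]
              exact ramificationIdx_over_eq_one L p v
                ⟨P.1, P.2.1, Ideal.ne_bot_of_liesOver_of_ne_bot v.ne_bot P.1⟩ (hw := P.2.2) h2) h1)
          _ gramToy_isHermitian isUnit_det_gramToy (notMem_badSet_gramToy _) T S)
    (fun h2' =>
      (Set.ncard_eq_two.mp h2').elim fun x h => h.elim fun z h =>
        have hx : x ∈ v.asIdeal.primesOver (𝓞 L) := by rw [h.2]; exact Set.mem_insert x _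
        have hz : z ∈ v.asIdeal.primesOver (𝓞 L) := by rw [h.2]; exact Set.mem_insert_of_mem x rfl
        haveI := hx.1
        haveI := hx.2
        haveI := hz.1
        haveI := hz.2
        @heckeAlgebra_mul_comm_record_of_ne_of_liesOver L _ (numberField L) (isCMField_four L) v
          ⟨x, hx.1, Ideal.ne_bot_of_liesOver_of_ne_bot v.ne_bot x⟩
          ⟨z, hz.1, Ideal.ne_bot_of_liesOver_of_ne_bot v.ne_bot z⟩ _ l k _ hl
          (fun hxz => h.1 (congrArg HeightOneSpectrum.asIdeal hxz)) hx.2 hz.2 _ _ _ _ gramToy_isHermitian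
          isUnit_det_gramToy (notMem_badSet_gramToy _) T S)

end Four

section Intrinsic

variable (L : Type*) [Field L] [CharZero L] [IsCyclotomicExtension {2 ^ 2} ℚ L]
variable (v : HeightOneSpectrum (𝓞 (maximalRealSubfield L)))

omit [CharZero L] [IsCyclotomicExtension {2 ^ 2} ℚ L] in
/-- If `v` lies above `p` and `2 ∉ v`, then `p` is odd. -/
theorem not_dvd_four_of_notMem [NumberField L] (p : ℕ) [hp : Fact p.Prime]
    [hv : v.asIdeal.LiesOver (Ideal.span {(p : ℤ)})] (h2 : (2 : 𝓞 (maximalRealSubfield L)) ∉ v.asIdeal) :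
    ¬ p ∣ 2 ^ 2 := by
  intro hdvd
  have hp2 : p = 2 := (Nat.prime_dvd_prime_iff_eq hp.out Nat.prime_two).mp (hp.out.dvd_of_dvd_pow hdvd)
  apply h2
  have hmem : (p : ℤ) ∈ Ideal.span {(p : ℤ)} := Ideal.mem_span_singleton_self (p : ℤ)
  rw [Ideal.mem_of_liesOver v.asIdeal (Ideal.span {(p : ℤ)}) p, map_natCast, hp2, Nat.cast_ofNat] at hmem
  exact hmem

/-- **THE INTRINSIC FORM ON THE TOY FIELD: `H(U(1 ⊗ H₀), K_v)` IS COMMUTATIVE AT EVERY PLACE `v` OF `ℚ(i)⁺` WITH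
`2 ∉ v`.** -/
theorem heckeAlgebra_mul_comm_record_four_of_notMem (h2 : (2 : 𝓞 (maximalRealSubfield L)) ∉ v.asIdeal)
    (k : Type*) [Field k] {r : ℕ} (l : Fin r → 𝓞 L)
    (hl : Submodule.span (𝓞 (maximalRealSubfield L)) (Set.range l) = ⊤)
    (T S : (haveI := numberField L; haveI := isCMField_four L; letI := tensorStarRing L v;
      ↥(heckeAlgebra k (recordHyperspecial L v l (gramToy L))))) :
    T * S = S * T :=
  haveI := numberField L
  haveI := isCMField_four L
  (exists_prime_liesOver (maximalRealSubfield L) v).elim fun p h =>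
    haveI : Fact p.Prime := ⟨h.1⟩
    haveI := h.2
    heckeAlgebra_mul_comm_record_four L p v (not_dvd_four_of_notMem L v p h2) k l hl T S

end Intrinsic

section Dyadic

variable (L : Type*) [Field L] [CharZero L] [IsCyclotomicExtension {2 ^ 2} ℚ L]

/-- `2` is prime (as a `Fact`). -/
theorem fact_prime_two : Fact (Nat.Prime 2) := ⟨Nat.prime_two⟩

variable (P : Ideal (𝓞 L)) [P.IsPrime] [P.LiesOver (Ideal.span {((2 : ℕ) : ℤ)})]

/-- **`e(P/2) = 2`** for the prime of `ℚ(i)` above `2` (Mathlib's `ramificationIdx_eq_of_prime_pow` at `2²`). -/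
theorem ramificationIdx_of_liesOver_two :
    haveI := numberField L
    P.ramificationIdx ℤ = 2 := by
  haveI := numberField L
  haveI := fact_prime_two
  have h := IsCyclotomicExtension.Rat.ramificationIdx_eq_of_prime_pow 2 1 L P
  rwa [pow_one] at h

/-- **`f(P/2) = 1`** (Mathlib's `inertiaDeg_eq_of_prime_pow`). -/
theorem inertiaDeg_of_liesOver_two :
    haveI := numberField L
    P.inertiaDeg ℤ = 1 := by
  haveI := numberField L
  haveI := fact_prime_two
  exact IsCyclotomicExtension.Rat.inertiaDeg_eq_of_prime_pow 2 1 L P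

variable (v : HeightOneSpectrum (𝓞 (maximalRealSubfield L))) [hv : v.asIdeal.LiesOver (Ideal.span {((2 : ℕ) : ℤ)})]
variable (w : HeightOneSpectrum (𝓞 L)) [hw : w.asIdeal.LiesOver v.asIdeal]
include hv hw

omit w hw in
/-- **`N(v) = 2`** at the dyadic place of `ℚ(i)⁺`. -/
theorem absNorm_eq_two :
    haveI := numberField L; haveI := isCMField_four L
    Ideal.absNorm v.asIdeal = 2 :=
  haveI := fact_prime_two
  absNorm_eq L 2 v

/-- **`e(w/v) = 2`: THE DYADIC PLACE OF `ℚ(i)⁺` RAMIFIES IN `ℚ(i)`** — `e(v/2) ≤ [ℚ(i)⁺ : ℚ] = 1` (Mathlib's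
`ramificationIdx_le_finrank`) and the tower law `e(v/2) · e(w/v) = e(w/2) = 2`. -/
theorem ramificationIdx_over_eq_two_of_liesOver_two :
    haveI := numberField L; haveI := isCMField_four L
    w.asIdeal.ramificationIdx (𝓞 (maximalRealSubfield L)) = 2 := by
  haveI := numberField L
  haveI := isCMField_four L
  haveI := fact_prime_two
  haveI : w.asIdeal.LiesOver (Ideal.span {((2 : ℕ) : ℤ)}) := Ideal.LiesOver.trans w.asIdeal v.asIdeal _
  haveI : (Ideal.span {((2 : ℕ) : ℤ)}).IsMaximal :=
    Ideal.IsPrime.isMaximal ((Ideal.span_singleton_prime (by norm_num)).mpr (by norm_num)) (by norm_num)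
  have hle := Ideal.ramificationIdx_le_finrank (𝓞 (maximalRealSubfield L)) ℚ (maximalRealSubfield L) v.asIdeal
    (p := Ideal.span {((2 : ℕ) : ℤ)})
  rw [finrank_rat_maximalRealSubfield L, Ideal.ramificationIdx'_eq_ramificationIdx _ v.asIdeal (by norm_num)] at hle
  have hpos := Ideal.ramificationIdx_pos v.asIdeal ℤ
  have htower := Ideal.ramificationIdx_tower (R := ℤ) v.asIdeal w.asIdeal
  rw [ramificationIdx_of_liesOver_two L w.asIdeal, show v.asIdeal.ramificationIdx ℤ = 1 by omega, one_mul]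
    at htower
  exact htower.symm

end Dyadic

end Summit.Ventures.HodgeRepro2.T5CyclotomicFourPlaceCensus
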